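import Summits.Ventures.PercRepro.S1CoreStarPlane

/-!
# PercRepro — the parallel classes of `M ／ {e}` and the lines of the 4-circuits through `e` (p1, gen 22; the s₄ seat)

`proofs/P1-S4-CAPBRIDGE.md` §2. The 4-circuit-cap search (`S1CoreCapSpec`) lives on the simplification of
`N = M ／ {e}`: its points are the PARALLEL CLASSES of `N`, which on the e-free core are the M-lines through `e`
minus `e` (`cls M e p := cl {e, p} ∖ {e}`, one or two points), and its lines are the planes of `M` through `e`
(the plane `cl C` of a 4-circuit `C ∋ e`, read as the `Finset` of classes of its points, `lineOf M e C`). This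
module sets up these objects on `Set α` (classes as sets, lines as `Finset (Set α)`, `pts L = ⋃₀ L`) and proves
what the bridge needs: classes are well defined and pairwise disjoint, two points of distinct classes span rank 3
with `e`, a class has `≤ 2` points, the points of a line are its plane minus `e`, a plane is determined by its
line, the line of a 4-circuit has `≥ 3` classes, and `|pts L| = Σ_{v ∈ L} |v|`.
Axioms: standard.
-/

open scoped Matroid

namespace PercRepro

namespace S1

open Set

variable {α : Type}

/-- The parallel class of `p` in `M ／ {e}`: the M-line through `e` and `p`, minus `e`. -/
def cls (M : Matroid α) (e p : α) : Set α := M.closure {e, p} \ {e}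

/-- A pair spans rank at most 2. -/
theorem eRk_pair_le_two (M : Matroid α) (e p : α) : M.eRk {e, p} ≤ 2 := by
  refine (M.eRk_le_encard _).trans ?_
  refine (encard_insert_le _ _).trans ?_
  rw [encard_singleton]; norm_num

/-- On the core, two distinct points span rank exactly 2. -/
theorem eRk_pair_eq_two (M : Matroid α) [M.Finite]
    (hfree : ∀ e ∈ M.E, ∃ A ⊆ M.E \ {e}, e ∉ M.closure A ∧ e ∉ M.closure ((M.E \ {e}) \ A))
    {e p : α} (he : e ∈ M.E) (hp : p ∈ M.E) (hep : e ≠ p) : M.eRk {e, p} = 2 := by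
  have hsub : ({e, p} : Set α) ⊆ M.E := by
    intro t ht; simp only [mem_insert_iff, mem_singleton_iff] at ht; rcases ht with rfl | rfl; exact he; exact hp
  refine le_antisymm (eRk_pair_le_two M e p) ?_
  by_contra hlt
  push Not at hlt
  have h1 : M.eRk {e, p} ≤ 1 := by simpa using hlt
  have := ThmN.ncard_add_one_le_two_pow_of_eRk_le M (ThmN.not_isLoop_of_free M hfree) hfree 1 _ hsub h1
  rw [ncard_pair hep] at this
  omega

/-- A point lies in its own class. -/
theorem mem_cls_self (M : Matroid α) {e p : α} (hp : p ∈ M.E) (hep : e ≠ p) : p ∈ cls M e p :=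
  ⟨M.mem_closure_of_mem' (by simp) hp, fun h => hep (mem_singleton_iff.1 h).symm⟩

/-- A class lies in the ground set and avoids `e`. -/
theorem cls_subset (M : Matroid α) (e p : α) : cls M e p ⊆ M.E \ {e} :=
  fun _ ht => ⟨M.closure_subset_ground _ ht.1, ht.2⟩

/-- A point of the class of `p` lies in `cl {e, p}`. -/
theorem mem_closure_of_mem_cls (M : Matroid α) {e p q : α} (hq : q ∈ cls M e p) : q ∈ M.closure {e, p} := hq.1

/-- A point of a class is not `e`. -/
theorem ne_of_mem_cls (M : Matroid α) {e p q : α} (hq : q ∈ cls M e p) : q ≠ e :=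
  fun h => hq.2 (mem_singleton_iff.2 h)

/-- A point of a class lies in the ground set. -/
theorem mem_ground_of_mem_cls (M : Matroid α) {e p q : α} (hq : q ∈ cls M e p) : q ∈ M.E :=
  M.closure_subset_ground _ hq.1

/-- A class lies inside every closure containing `e` and its representative. -/
theorem cls_subset_closure (M : Matroid α) {e p : α} {X : Set α} (heX : e ∈ M.closure X)
    (hpX : p ∈ M.closure X) : cls M e p ⊆ M.closure X := by
  intro t ht
  refine M.closure_subset_closure_of_subset_closure ?_ ht.1
  intro s hs; simp only [mem_insert_iff, mem_singleton_iff] at hs; rcases hs with rfl | rfl; exact heX; exact hpX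

/-- A class has at most two points (lines of the core have `≤ 3` points). -/
theorem ncard_cls_le_two (M : Matroid α) [M.Finite]
    (hfree : ∀ e ∈ M.E, ∃ A ⊆ M.E \ {e}, e ∉ M.closure A ∧ e ∉ M.closure ((M.E \ {e}) \ A))
    {e : α} (he : e ∈ M.E) (p : α) : (cls M e p).ncard ≤ 2 := by
  have hr : M.eRk (M.closure {e, p}) ≤ 2 := by rw [M.eRk_closure_eq]; exact eRk_pair_le_two M e p
  have h3 := ThmN.ncard_add_one_le_two_pow_of_eRk_le M (ThmN.not_isLoop_of_free M hfree) hfree 2 _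
    (M.closure_subset_ground _) hr
  have hecl : e ∈ M.closure {e, p} := M.mem_closure_of_mem' (by simp) he
  have := ncard_sdiff_singleton_add_one hecl (M.ground_finite.subset (M.closure_subset_ground _))
  unfold cls
  omega

/-- A class is nonempty (it contains its representative) and finite. -/
theorem cls_finite (M : Matroid α) [M.Finite] (e p : α) : (cls M e p).Finite :=
  M.ground_finite.subset ((cls_subset M e p).trans sdiff_subset)

/-- The line through `e` and a point `q` of the line through `e, p` is that line. -/
theorem closure_pair_eq_of_mem (M : Matroid α) [M.Finite]
    (hfree : ∀ e ∈ M.E, ∃ A ⊆ M.E \ {e}, e ∉ M.closure A ∧ e ∉ M.closure ((M.E \ {e}) \ A))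
    {e p q : α} (he : e ∈ M.E) (hp : p ∈ M.E) (hep : e ≠ p) (hq : q ∈ cls M e p) :
    M.closure {e, q} = M.closure {e, p} := by
  have hqE : q ∈ M.E := mem_ground_of_mem_cls M hq
  have hqe : q ≠ e := ne_of_mem_cls M hq
  have h1 : M.closure {e, q} ⊆ M.closure {e, p} := by
    refine M.closure_subset_closure_of_subset_closure ?_
    intro s hs; simp only [mem_insert_iff, mem_singleton_iff] at hs
    rcases hs with rfl | rfl
    · exact M.mem_closure_of_mem' (by simp) he
    · exact hq.1
  refine le_antisymm h1 ?_
  refine M.closure_subset_closure_of_subset_closure ?_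
  intro s hs; simp only [mem_insert_iff, mem_singleton_iff] at hs
  rcases hs with rfl | rfl
  · exact M.mem_closure_of_mem' (by simp) he
  · by_contra hpcl
    have hins : M.eRk (insert s {e, q}) = M.eRk {e, q} + 1 := M.eRk_insert_eq_add_one ⟨hp, hpcl⟩
    have hsub : insert s {e, q} ⊆ M.closure {e, s} := by
      intro t ht; simp only [mem_insert_iff, mem_singleton_iff] at ht
      rcases ht with rfl | rfl | rfl
      · exact M.mem_closure_of_mem' (by simp) hp
      · exact M.mem_closure_of_mem' (by simp) he
      · exact hq.1
    have hle : M.eRk (insert s {e, q}) ≤ 2 := by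
      refine (M.eRk_mono hsub).trans ?_; rw [M.eRk_closure_eq]; exact eRk_pair_le_two M e s
    rw [hins, eRk_pair_eq_two M hfree he hqE hqe.symm] at hle
    exact absurd hle (by decide)

/-- Classes are well defined: the class of a point of `cls e p` is `cls e p`. -/
theorem cls_eq_of_mem (M : Matroid α) [M.Finite]
    (hfree : ∀ e ∈ M.E, ∃ A ⊆ M.E \ {e}, e ∉ M.closure A ∧ e ∉ M.closure ((M.E \ {e}) \ A))
    {e p q : α} (he : e ∈ M.E) (hp : p ∈ M.E) (hep : e ≠ p) (hq : q ∈ cls M e p) :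
    cls M e q = cls M e p := by
  unfold cls; rw [closure_pair_eq_of_mem M hfree he hp hep hq]

/-- Distinct classes are disjoint. -/
theorem cls_disjoint_of_ne (M : Matroid α) [M.Finite]
    (hfree : ∀ e ∈ M.E, ∃ A ⊆ M.E \ {e}, e ∉ M.closure A ∧ e ∉ M.closure ((M.E \ {e}) \ A))
    {e p q : α} (he : e ∈ M.E) (hp : p ∈ M.E) (hq : q ∈ M.E) (hep : e ≠ p) (heq : e ≠ q)
    (hne : cls M e p ≠ cls M e q) : Disjoint (cls M e p) (cls M e q) := by
  rw [Set.disjoint_left]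
  intro t htp htq
  exact hne ((cls_eq_of_mem M hfree he hp hep htp).symm.trans (cls_eq_of_mem M hfree he hq heq htq))

/-- Two points of distinct classes are independent with `e`: `r {e, p, q} = 3`. -/
theorem eRk_triple_eq_three_of_cls_ne (M : Matroid α) [M.Finite]
    (hfree : ∀ e ∈ M.E, ∃ A ⊆ M.E \ {e}, e ∉ M.closure A ∧ e ∉ M.closure ((M.E \ {e}) \ A))
    {e p q : α} (he : e ∈ M.E) (hp : p ∈ M.E) (hq : q ∈ M.E) (hep : e ≠ p) (heq : e ≠ q)
    (hne : cls M e p ≠ cls M e q) : M.eRk {e, p, q} = 3 := by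
  have hqcl : q ∉ M.closure {e, p} := by
    intro hqcl
    exact hne (cls_eq_of_mem M hfree he hp hep ⟨hqcl, fun h => heq (mem_singleton_iff.1 h).symm⟩).symm
  have h1 : ({e, p, q} : Set α) = insert q {e, p} := by
    ext t; simp only [mem_insert_iff, mem_singleton_iff]; tauto
  rw [h1, M.eRk_insert_eq_add_one ⟨hq, hqcl⟩, eRk_pair_eq_two M hfree he hp hep]
  rfl

/-- Two points of one class span rank `≤ 2` with `e`. -/
theorem eRk_triple_le_two_of_mem_cls (M : Matroid α) {e p q : α} (he : e ∈ M.E) (hp : p ∈ M.E)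
    (hq : q ∈ cls M e p) : M.eRk {e, p, q} ≤ 2 := by
  have hsub : ({e, p, q} : Set α) ⊆ M.closure {e, p} := by
    intro t ht; simp only [mem_insert_iff, mem_singleton_iff] at ht
    rcases ht with rfl | rfl | rfl
    · exact M.mem_closure_of_mem' (by simp) he
    · exact M.mem_closure_of_mem' (by simp) hp
    · exact hq.1
  refine (M.eRk_mono hsub).trans ?_
  rw [M.eRk_closure_eq]; exact eRk_pair_le_two M e p


/-! ### Lines, the configuration, and the points of a line -/

/-- The 4-circuits through `e`. -/
def fourCircuitsThrough (M : Matroid α) (e : α) : Set (Set α) := {C | M.IsCircuit C ∧ C.ncard = 4 ∧ e ∈ C}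

/-- The 4-circuits through `e` form a finite set. -/
theorem fourCircuitsThrough_finite (M : Matroid α) [M.Finite] (e : α) : (fourCircuitsThrough M e).Finite :=
  M.ground_finite.finite_subsets.subset (fun _ hC => hC.1.subset_ground)

open Classical in
/-- The classes of a plane `P ∋ e` (the line of `M ／ {e}` it defines): the classes of its points other than `e`. -/
noncomputable def lineOfPlane (M : Matroid α) [M.Finite] (e : α) (P : Set α) : Finset (Set α) :=
  (M.ground_finite.subset (show (P ∩ M.E) \ {e} ⊆ M.E from sdiff_subset.trans inter_subset_right)).toFinset.image
    (cls M e)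

/-- Membership in the line of a plane: the classes of its points other than `e`. -/
theorem mem_lineOfPlane {M : Matroid α} [M.Finite] {e : α} {P : Set α} {v : Set α} :
    v ∈ lineOfPlane M e P ↔ ∃ q ∈ (P ∩ M.E) \ {e}, cls M e q = v := by
  unfold lineOfPlane
  simp only [Finset.mem_image, Set.Finite.mem_toFinset]

/-- The line of a 4-circuit `C ∋ e`: the classes of its plane `cl C`. -/
noncomputable def lineOf (M : Matroid α) [M.Finite] (e : α) (C : Set α) : Finset (Set α) :=
  lineOfPlane M e (M.closure C)

open Classical in
/-- The configuration of `e`: the lines of all 4-circuits through `e`. -/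
noncomputable def config (M : Matroid α) [M.Finite] (e : α) : Finset (Finset (Set α)) :=
  (fourCircuitsThrough_finite M e).toFinset.image (lineOf M e)

/-- Membership in the configuration: the lines of the 4-circuits through `e`. -/
theorem mem_config {M : Matroid α} [M.Finite] {e : α} {L : Finset (Set α)} :
    L ∈ config M e ↔ ∃ C, (M.IsCircuit C ∧ C.ncard = 4 ∧ e ∈ C) ∧ lineOf M e C = L := by
  unfold config
  simp only [Finset.mem_image, Set.Finite.mem_toFinset, fourCircuitsThrough, mem_setOf_eq]

/-- The points of a set of classes. -/
def pts (L : Finset (Set α)) : Set α := ⋃₀ (↑L : Set (Set α))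

/-- Membership in the points of a set of classes. -/
theorem mem_pts {L : Finset (Set α)} {t : α} : t ∈ pts L ↔ ∃ v ∈ L, t ∈ v := by
  unfold pts; simp only [mem_sUnion, Finset.mem_coe]

/-- The points of no classes: none. -/
theorem pts_empty : pts (∅ : Finset (Set α)) = ∅ := by
  unfold pts; simp

/-- The points of `insert v L` are `v ∪ pts L`. -/
theorem pts_insert [DecidableEq (Set α)] (v : Set α) (L : Finset (Set α)) : pts (insert v L) = v ∪ pts L := by
  unfold pts; rw [Finset.coe_insert, sUnion_insert]

/-- The points of a union of sets of classes. -/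
theorem pts_union [DecidableEq (Set α)] (L L' : Finset (Set α)) : pts (L ∪ L') = pts L ∪ pts L' := by
  unfold pts; rw [Finset.coe_union, sUnion_union]

/-- `pts` is monotone. -/
theorem pts_mono {L L' : Finset (Set α)} (h : L ⊆ L') : pts L ⊆ pts L' := by
  intro t ht; rw [mem_pts] at ht ⊢; obtain ⟨v, hv, htv⟩ := ht; exact ⟨v, h hv, htv⟩

/-- Every member of a line is a class of a point of the ground set other than `e`. -/
theorem exists_rep_of_mem_lineOfPlane {M : Matroid α} [M.Finite] {e : α} {P : Set α} {v : Set α}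
    (hv : v ∈ lineOfPlane M e P) : ∃ q ∈ M.E, q ≠ e ∧ v = cls M e q := by
  obtain ⟨q, hq, rfl⟩ := mem_lineOfPlane.1 hv
  exact ⟨q, hq.1.2, fun h => hq.2 (mem_singleton_iff.2 h), rfl⟩

/-- The points of the line of a closed plane `P ∋ e` are `P ∖ {e}`. -/
theorem pts_lineOfPlane (M : Matroid α) [M.Finite] {e : α} {P : Set α} (hP : P ⊆ M.E) (hPcl : M.closure P = P)
    (he : e ∈ P) : pts (lineOfPlane M e P) = P \ {e} := by
  ext t
  rw [mem_pts]
  constructor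
  · rintro ⟨v, hv, htv⟩
    obtain ⟨q, hq, rfl⟩ := mem_lineOfPlane.1 hv
    refine ⟨?_, fun h => (ne_of_mem_cls M htv) (mem_singleton_iff.1 h)⟩
    have hsub : cls M e q ⊆ M.closure P :=
      cls_subset_closure M (M.mem_closure_of_mem' he (hP he)) (M.mem_closure_of_mem' hq.1.1 hq.1.2)
    rw [hPcl] at hsub
    exact hsub htv
  · rintro ⟨htP, hte⟩
    have hte' : e ≠ t := fun h => hte (mem_singleton_iff.2 h.symm)
    exact ⟨cls M e t, mem_lineOfPlane.2 ⟨t, ⟨⟨htP, hP htP⟩, hte⟩, rfl⟩, mem_cls_self M (hP htP) hte'⟩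

/-- The points of the line of a 4-circuit `C ∋ e` are `cl C ∖ {e}`. -/
theorem pts_lineOf (M : Matroid α) [M.Finite] {e : α} {C : Set α} (hC : C ⊆ M.E) (he : e ∈ C) :
    pts (lineOf M e C) = M.closure C \ {e} :=
  pts_lineOfPlane M (M.closure_subset_ground C) (M.closure_closure C) (M.mem_closure_of_mem' he (hC he))

/-- Two 4-circuits through `e` with the same line span the same plane. -/
theorem closure_eq_of_lineOf_eq (M : Matroid α) [M.Finite] {e : α} {C C' : Set α} (hC : C ⊆ M.E) (hC' : C' ⊆ M.E)
    (he : e ∈ C) (he' : e ∈ C') (h : lineOf M e C = lineOf M e C') : M.closure C = M.closure C' := by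
  have h1 := pts_lineOf M hC he
  have h2 := pts_lineOf M hC' he'
  rw [h] at h1
  have h3 : M.closure C \ {e} = M.closure C' \ {e} := h1.symm.trans h2
  have he1 : e ∈ M.closure C := M.mem_closure_of_mem' he (hC he)
  have he2 : e ∈ M.closure C' := M.mem_closure_of_mem' he' (hC' he')
  rw [← insert_sdiff_singleton.trans (insert_eq_of_mem he1), h3, insert_sdiff_singleton, insert_eq_of_mem he2]

/-- The number of points of a set of pairwise distinct classes is the sum of the class sizes. -/
theorem ncard_pts_eq_sum (M : Matroid α) [M.Finite]
    (hfree : ∀ e ∈ M.E, ∃ A ⊆ M.E \ {e}, e ∉ M.closure A ∧ e ∉ M.closure ((M.E \ {e}) \ A))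
    {e : α} (he : e ∈ M.E) (L : Finset (Set α)) (hL : ∀ v ∈ L, ∃ q ∈ M.E, q ≠ e ∧ v = cls M e q) :
    (pts L).ncard = ∑ v ∈ L, v.ncard := by
  classical
  induction L using Finset.induction_on with
  | empty => simp [pts_empty]
  | insert v S hvS ih =>
    rw [pts_insert, Finset.sum_insert hvS, ← ih (fun u hu => hL u (Finset.mem_insert_of_mem hu))]
    obtain ⟨q, hqE, hqe, rfl⟩ := hL v (Finset.mem_insert_self v S)
    have hfinS : (pts S).Finite := by
      unfold pts
      refine Set.Finite.sUnion (Finset.finite_toSet S) (fun u hu => ?_)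
      obtain ⟨r, _, _, rfl⟩ := hL u (Finset.mem_insert_of_mem (Finset.mem_coe.1 hu))
      exact cls_finite M e r
    refine ncard_union_eq ?_ (cls_finite M e q) hfinS
    unfold pts
    rw [disjoint_sUnion_right]
    intro u hu
    obtain ⟨r, hrE, hre, rfl⟩ := hL u (Finset.mem_insert_of_mem (Finset.mem_coe.1 hu))
    refine cls_disjoint_of_ne M hfree he hqE hrE hqe.symm hre.symm ?_
    intro heq
    exact hvS (heq ▸ Finset.mem_coe.1 hu)

/-- A set of distinct classes has at most as many members as points. -/
theorem card_le_ncard_pts (M : Matroid α) [M.Finite]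
    (hfree : ∀ e ∈ M.E, ∃ A ⊆ M.E \ {e}, e ∉ M.closure A ∧ e ∉ M.closure ((M.E \ {e}) \ A))
    {e : α} (he : e ∈ M.E) (L : Finset (Set α)) (hL : ∀ v ∈ L, ∃ q ∈ M.E, q ≠ e ∧ v = cls M e q) :
    L.card ≤ (pts L).ncard := by
  rw [ncard_pts_eq_sum M hfree he L hL, Finset.card_eq_sum_ones]
  refine Finset.sum_le_sum (fun v hv => ?_)
  obtain ⟨q, hqE, hqe, rfl⟩ := hL v hv
  exact ncard_pos (cls_finite M e q) |>.2 ⟨q, mem_cls_self M hqE hqe.symm⟩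

/-- Two points of a 4-circuit `C ∋ e` other than `e` lie in distinct classes. -/
theorem cls_ne_of_mem_fourCircuit (M : Matroid α) {C : Set α} (hC : M.IsCircuit C) (h4 : C.ncard = 4)
    {e p q : α} (he : e ∈ C) (hp : p ∈ C) (hq : q ∈ C) (hep : e ≠ p) (heq : e ≠ q) (hpq : p ≠ q) :
    cls M e p ≠ cls M e q := by
  intro hcls
  have h1 := (fourCircuit_inter_closure_pair M hC h4 he hp hep).1
  have hqcls : q ∈ cls M e p := hcls ▸ mem_cls_self M (hC.subset_ground hq) heq
  have hq2 : q ∈ C ∩ M.closure {e, p} := ⟨hq, hqcls.1⟩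
  rw [h1] at hq2
  simp only [mem_insert_iff, mem_singleton_iff] at hq2
  rcases hq2 with rfl | rfl
  · exact heq rfl
  · exact hpq rfl

/-- The line of a 4-circuit through `e` has at least 3 classes. -/
theorem three_le_card_lineOf (M : Matroid α) [M.Finite] {C : Set α} (hC : M.IsCircuit C) (h4 : C.ncard = 4)
    {e : α} (he : e ∈ C) : 3 ≤ (lineOf M e C).card := by
  have hCfin : C.Finite := M.ground_finite.subset hC.subset_ground
  have h3 : (C \ {e}).ncard = 3 := by
    have := ncard_sdiff_singleton_add_one he hCfin; omega
  have hinj : InjOn (cls M e) (C \ {e}) := by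
    intro p hp q hq hpq
    by_contra hne
    exact cls_ne_of_mem_fourCircuit M hC h4 he hp.1 hq.1 (fun h => hp.2 (mem_singleton_iff.2 h.symm))
      (fun h => hq.2 (mem_singleton_iff.2 h.symm)) hne hpq
  have himg : cls M e '' (C \ {e}) ⊆ (↑(lineOf M e C) : Set (Set α)) := by
    rintro v ⟨q, hq, rfl⟩
    rw [Finset.mem_coe]
    exact mem_lineOfPlane.2 ⟨q, ⟨⟨M.mem_closure_of_mem' hq.1 (hC.subset_ground hq.1), hC.subset_ground hq.1⟩,
      hq.2⟩, rfl⟩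
  have := ncard_le_ncard himg (Finset.finite_toSet _)
  rw [hinj.ncard_image, h3, ncard_coe_finset] at this
  exact this

/-- The plane of a 4-circuit has rank 3. -/
theorem eRk_closure_fourCircuit (M : Matroid α) [M.Finite] {C : Set α} (hC : M.IsCircuit C) (h4 : C.ncard = 4) :
    M.eRk (M.closure C) = 3 := by
  rw [M.eRk_closure_eq]
  have hCfin : C.Finite := M.ground_finite.subset hC.subset_ground
  have h := hC.eRk_add_one_eq
  rw [← Set.Finite.cast_ncard_eq hCfin, h4] at h
  have hne : M.eRk C ≠ ⊤ := by
    refine ne_top_of_le_ne_top (ENat.coe_ne_top 4) ?_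
    rw [← h4, Set.Finite.cast_ncard_eq hCfin]; exact M.eRk_le_encard C
  obtain ⟨k, hk⟩ := ENat.ne_top_iff_exists.1 hne
  rw [← hk] at h ⊢
  have h' : k + 1 = 4 := by exact_mod_cast h
  have hk3 : k = 3 := by omega
  subst hk3; rfl

/-- Every member of the line of a 4-circuit is a class of a point of `cl C ∖ {e}`. -/
theorem exists_rep_of_mem_lineOf {M : Matroid α} [M.Finite] {e : α} {C : Set α} {v : Set α}
    (hv : v ∈ lineOf M e C) : ∃ q ∈ M.E, q ≠ e ∧ v = cls M e q :=
  exists_rep_of_mem_lineOfPlane hv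

/-- Every member of a line of the configuration is a class. -/
theorem exists_rep_of_mem_config {M : Matroid α} [M.Finite] {e : α} {L : Finset (Set α)} (hL : L ∈ config M e)
    {v : Set α} (hv : v ∈ L) : ∃ q ∈ M.E, q ≠ e ∧ v = cls M e q := by
  obtain ⟨C, _, rfl⟩ := mem_config.1 hL
  exact exists_rep_of_mem_lineOf hv


end S1

end PercRepro
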